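import Literature.Geometry.Kaehler.ComplexTorusSelfIntersectionIndex
import Literature.Geometry.Kaehler.ComplexTorusThetaKunnethFinite
import Literature.Geometry.Kaehler.ComplexTorusThetaDivisorProduct
import Literature.Geometry.Kaehler.ComplexTorusAppellHumbertGroup
import Summits.Ventures.HSemireg.SecantParityObjectLevel
import HarnessLib

/-!
# Venture HSemireg — (S3)'s positivity input under PRODUCTS: the index of `H_{b₁ ⊞ b₂}` is `index H_{b₁} + index H_{b₂}`
# (Sylvester), so on `X₁ × X₂` of even dimension `n`, (H1) «`∫ (b₁ ⊞ b₂)ⁿ > 0`» ⟺ `s(b₁) + s(b₂)` even; same for finite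
# products `X₀ × ⋯ × X_{r-1}` — TRACK S4-PUSH (ii), seat `s4-prove-1` (g9); file of record `s4push/prove-1/ATTEMPT-10.md` §1;
# file V-a of the lane's object-level series (III `SecantParityObjectLevel`, IV `…SignedLaw`, IVb `…EFour`)

HONEST FRAMING. Lean index of the computation cell `pub-hsemireg`. OBJECT LEVEL in the sense of file III, and only that object:
the complex torus `X = E/Φ(ℤ^ι)` of the tree's Literature layer `Literature/Geometry/Kaehler/ComplexTorus*` (lane `lit-hodgefound`),
`∫_X := ComplexTorus.torusIntegral` (complex orientation), `ComplexTorus.IsNSForm`, the intrinsic index `ComplexTorus.hermIndex` of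
`H_η(v, w) = η(iv, w) + iη(v, w)` (Lange's `H`), the binary product torus `prodPeriod Φ₁ Φ₂` with `prodForm η₁ η₂ = p₁^*η₁ + p₂^*η₂`
(«`η₁ ⊞ η₂`») and the finite product `piPeriod Φ` / `piForm η = Σ_k p_k^* η_k` of a family on one ambient space.  No sheaf, no secant
plane, no Ext group and no semiregularity map is constructed; nothing here says that HC, HC_CM or HC_AV holds; nothing here is a new
case of anything; (S3)'s signed words («PROVED given `∫bⁿ > 0`», STRUCTURE.md v1.0 §2; STATUS WORD s4-ref P-2) do not move.
NO definition, NO named fact: theorems only, all PROVED (0 sorry), standard axioms.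

WHAT IS ADDED TO THE LANE'S RECORD (sheet `s4push/prove-1/STATEMENTS-S3INPUT.md`, new row S3INP-10 (a)).  Files III/IV made
«(H1) ⟺ `g + index` even» a theorem about `∫_X` and exhibited ONE class of intermediate index per file (`E_τ ⊞ (−E_τ')`, index `1`;
`η₄` on `E⁴`, index `1`), each computed by hand on a diagonal basis.  The law behind those computations is SYLVESTER ADDITIVITY:
* `hermIndex_prodForm` — for `η₁, η₂` of type `(1,1)` and non-degenerate (finite-dimensional `E₁, E₂`):
  **`hermIndex (η₁ ⊞ η₂) = hermIndex η₁ + hermIndex η₂`** (an `H₁`-orthogonal basis and an `H₂`-orthogonal basis concatenate to an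
  `H₁ ⊕ H₂`-orthogonal basis of `E₁ × E₂` — tree `hermOf_prodForm` — and the tree's Sylvester count `hermIndex_eq_card_of_orthogonal` adds);
  `nondegenerate_prodForm`; `hermIndex_prodForm_of_isNSForm` (the `NS` wording);
* `hermIndex_neg_add_hermIndex` — the orientation flip of the sheet's §0 (`b ↦ −b`): `index H_{−η} + index H_η = g`, so at even `g` the parity
  of the index, hence (H1), is orientation-independent (`even_hermIndex_neg_iff`);
* `hermIndex_piForm` — the same for `⊞_{k<r} η_k` on `E^r` (tree `hermOf_piForm`, Mathlib `Pi.basis`): **`hermIndex (⊞ η_k) = Σ_k hermIndex η_k`**;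
  `nondegenerate_piForm`; `hermIndex_piForm_of_isNSForm`;
* the (S3) read-out, by file III's criterion `torusIntegral_wedgePow_pos_iff_even'`:
  **`torusIntegral_wedgePow_prodForm_pos_iff`** — for `ηᵢ ∈ NS(Xᵢ)` non-degenerate and `dim (X₁ × X₂) = g`:
  `0 < ∫_{X₁×X₂} (η₁ ⊞ η₂)^{∧g} ⟺ Even (g + hermIndex η₁ + hermIndex η₂)`; at even `g` ⟺ `s(η₁) + s(η₂)` even
  (`…_pos_iff_of_even`) — (H1) for a product secant direction is the parity of the SUM of the indices: two polarisations, or two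
  classes of odd index, give (H1); a polarisation times an odd-index class does not; `hermIndex_prodForm_neg_of_isRiemannForm` (a polarisation ⊞ an
  anti-polarisation has index `dim X₂` — the law behind IV's witness) with `…_prodForm_neg_pos_iff_of_isRiemannForm` ((H1) ⟺ `dim X₂` even); and
  **`torusIntegral_wedgePow_piForm_pos_iff`** —
  `0 < ∫_{∏X_k} (⊞η_k)^{∧g} ⟺ Even (g + Σ_k hermIndex η_k)`.
The explicit all-dimension family (every index `0 ≤ s ≤ g` on `E_τ^g`, `∫ = (-1)^{g+s} g!`) is the companion file V-b
`SecantParityObjectLevelDiagonalClasses.lean` (independent of this file).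

PRESEARCH (2026-08-23, g9): the Literature layer has `hermIndex` lemmas for pull-backs, duals, positive rescaling, Riemann forms and the
Poincaré form (`ComplexTorusDualPolarizationIndex`, `ComplexTorusSelfIntersectionIndex`), none for `prodForm`/`piForm`
(`lean search hermIndex_prod|hermIndex_pi` → none); corpus: Sylvester additivity under orthogonal sum is textbook
[GohbergLancasterRodman2005 §2.3]; Lange §2.4.4 Cor. 2.4.24/Thm. 2.4.25 give `H = H₁ ⊕ H₂` for `p₁^*L₁ ⊗ p₂^*L₂`.  Offered upstream to
`lit-hodgefound` (belongs next to `hermIndex_eq_card_of_orthogonal`); kept here meanwhile, venture namespace, no Literature name shadowed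
(helper names carry `_aux`).

Statements and proofs: s4-prove-1 g9 (2026-08-23), seat ×1 + kernel; reads invited: s4-ref (statement read), s4-prove-3 (×2).

## References

* [Lange2023AbelianVarietiesComplex] H. Lange, Abelian Varieties over the Complex Numbers (2023), §1.2.2 Lemma 1.2.10, §1.6.2 (index, p. 66),
  §1.7.1 Thm. 1.7.1, §1.7.2 Thm. 1.7.3 and Lemma 1.7.5, §2.4.4 Cor. 2.4.24 and Thm. 2.4.25 — held text `book:lange1992-complex-abelian-varieties`
  (2023 numbering), as cited in the imported Literature files.
* [GohbergLancasterRodman2005] I. Gohberg, P. Lancaster, L. Rodman, Indefinite Linear Algebra and Applications (2005), §2.2, §2.3 (2.3.8) and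
  Thm. 2.3.2 (Sylvester's law of inertia) — as cited in `ComplexTorusSelfIntersectionIndex.lean`.
* Cell records: STATEMENTS-S3INPUT.md rows S3INP-1, -4, -7, -9, -10; ATTEMPT-10.md §1; files III/IV/IVb.
-/

noncomputable section

open scoped ComplexOrder
open Complex Module
open Literature.Geometry.Kaehler Literature.Geometry.Kaehler.ComplexTorus

namespace Summit.Ventures.HSemireg

namespace SecantParity

/-! ### §0 Folklore helpers on `H = hermOf η` -/

section Helpers

variable {E : Type*} [NormedAddCommGroup E] [NormedSpace ℂ E]

/-- `H(0, w) = 0` (`H` is `ℂ`-linear in the first slot). [cite: Lange2023AbelianVarietiesComplex, §1.2.2 Lemma 1.2.10] -/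
theorem hermOf_zero_left_aux (η : E [⋀^Fin 2]→L[ℝ] ℝ) (w : E) : hermOf η 0 w = 0 := by
  simpa using hermOf_smul_left η 0 0 w

/-- `H(v, 0) = 0`. [cite: Lange2023AbelianVarietiesComplex, §1.2.2 Lemma 1.2.10] -/
theorem hermOf_zero_right_aux (η : E [⋀^Fin 2]→L[ℝ] ℝ) (v : E) : hermOf η v 0 = 0 := by
  rw [hermOf_apply, η.map_coord_zero 1 rfl, η.map_coord_zero (m := ![v, 0]) 1 rfl]
  simp

end Helpers

/-! ### §0b The orientation flip `η ↦ −η`: `index H_{−η} + index H_η = g` -/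

section Neg

variable {E : Type*} [NormedAddCommGroup E] [NormedSpace ℂ E] [FiniteDimensional ℂ E] (η : E [⋀^Fin 2]→L[ℝ] ℝ)

/-- **`index H_{−η} + index H_η = dim_ℂ E`** for `η` of type `(1,1)` and non-degenerate (an `H`-orthogonal basis with diagonal `c` is
`H_{−η}`-orthogonal with diagonal `−c`; Sylvester counts the complementary set).  The sheet's §0 orientation flip `ℓ ↔ ℓ̄`, `b ↦ −b`: at EVEN `g`
the parity of the index — hence (H1) — does not depend on the orientation (`even_hermIndex_neg_iff`).
[cite: GohbergLancasterRodman2005, §2.3 Thm. 2.3.2] [cite: Lange2023AbelianVarietiesComplex, §1.6.2 (p0066)] -/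
theorem hermIndex_neg_add_hermIndex (h11 : ∀ u v : E, η ![I • u, I • v] = η ![u, v])
    (hnd : ∀ v : E, v ≠ 0 → ∃ w : E, η ![v, w] ≠ 0) : hermIndex (-η) + hermIndex η = finrank ℂ E := by
  classical
  obtain ⟨w, c, hc, horth, hi⟩ := exists_orthogonal_basis_hermIndex η h11 hnd rfl
  have h11' : ∀ u v : E, (-η) ![I • u, I • v] = (-η) ![u, v] := fun u v ↦ by
    simp only [ContinuousAlternatingMap.neg_apply, h11]
  have horth' : ∀ k l, hermOf (-η) (w k) (w l) = if k = l then ((-c k : ℝ) : ℂ) else 0 := fun k l ↦ by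
    rw [hermOf_neg, horth]
    split_ifs <;> simp
  rw [hermIndex_eq_card_of_orthogonal _ h11' w (fun k ↦ -c k) (fun k ↦ neg_ne_zero.2 (hc k)) horth', hi]
  have hneg : (Finset.univ.filter fun k ↦ -c k < 0) = Finset.univ.filter fun k ↦ ¬ c k < 0 :=
    Finset.filter_congr fun k _ ↦ by
      rw [neg_lt_zero]
      exact ⟨fun h ↦ not_lt.2 h.le, fun h ↦ lt_of_le_of_ne (not_lt.1 h) (hc k).symm⟩
  rw [hneg, add_comm, Finset.card_filter_add_card_filter_not, Finset.card_univ, Fintype.card_fin]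

/-- … at EVEN dimension `g`: `index H_{−η}` is even iff `index H_η` is — (H1) for `b` ⟺ (H1) for `−b` (cf. file III's
`torusIntegral_wedgePow_smul_pos_iff` with `c = −1`). [cite: Lange2023AbelianVarietiesComplex, §1.7.1 Thm. 1.7.1 and §1.7.2 Thm. 1.7.3] -/
theorem even_hermIndex_neg_iff (h11 : ∀ u v : E, η ![I • u, I • v] = η ![u, v])
    (hnd : ∀ v : E, v ≠ 0 → ∃ w : E, η ![v, w] ≠ 0) (hg : Even (finrank ℂ E)) :
    Even (hermIndex (-η)) ↔ Even (hermIndex η) := by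
  have h := hermIndex_neg_add_hermIndex η h11 hnd
  rw [← h, Nat.even_add] at hg
  exact hg

end Neg

/-! ### §1 Sylvester additivity of the index under `⊞` on `E₁ × E₂`, and (H1) for `η₁ ⊞ η₂` on `X₁ × X₂` -/

section Prod

variable {E₁ E₂ : Type*} [NormedAddCommGroup E₁] [NormedSpace ℂ E₁] [FiniteDimensional ℂ E₁]
  [NormedAddCommGroup E₂] [NormedSpace ℂ E₂] [FiniteDimensional ℂ E₂]
  (η₁ : E₁ [⋀^Fin 2]→L[ℝ] ℝ) (η₂ : E₂ [⋀^Fin 2]→L[ℝ] ℝ)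

omit [FiniteDimensional ℂ E₁] [FiniteDimensional ℂ E₂] in
/-- `η₁ ⊞ η₂` is of type `(1,1)` when both summands are. [cite: Lange2023AbelianVarietiesComplex, §2.4.4 Cor. 2.4.24] -/
theorem typeOneOne_prodForm (h₁ : ∀ u v : E₁, η₁ ![I • u, I • v] = η₁ ![u, v])
    (h₂ : ∀ u v : E₂, η₂ ![I • u, I • v] = η₂ ![u, v]) (u v : E₁ × E₂) :
    prodForm η₁ η₂ ![I • u, I • v] = prodForm η₁ η₂ ![u, v] := by
  rw [prodForm_apply, prodForm_apply, Prod.smul_fst, Prod.smul_snd, Prod.smul_fst, Prod.smul_snd, h₁, h₂]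

omit [FiniteDimensional ℂ E₁] [FiniteDimensional ℂ E₂] in
/-- The product `w₁ ⊔ w₂` of an `H₁`-orthogonal and an `H₂`-orthogonal complex basis is `H_{η₁ ⊞ η₂}`-orthogonal, with the
concatenated diagonal (`H_{η₁ ⊞ η₂} = H₁ ⊕ H₂`, tree `hermOf_prodForm`). [cite: GohbergLancasterRodman2005, §2.3 (2.3.8)]
[cite: Lange2023AbelianVarietiesComplex, §2.4.4 Cor. 2.4.24] -/
theorem hermOf_prodForm_basisProd {κ₁ κ₂ : Type*} [DecidableEq κ₁] [DecidableEq κ₂]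
    (w₁ : Basis κ₁ ℂ E₁) (w₂ : Basis κ₂ ℂ E₂) (c₁ : κ₁ → ℝ) (c₂ : κ₂ → ℝ)
    (horth₁ : ∀ k l, hermOf η₁ (w₁ k) (w₁ l) = if k = l then (c₁ k : ℂ) else 0)
    (horth₂ : ∀ k l, hermOf η₂ (w₂ k) (w₂ l) = if k = l then (c₂ k : ℂ) else 0)
    (k l : κ₁ ⊕ κ₂) :
    hermOf (prodForm η₁ η₂) (w₁.prod w₂ k) (w₁.prod w₂ l) =
      if k = l then ((Sum.elim c₁ c₂ k : ℝ) : ℂ) else 0 := by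
  rw [hermOf_prodForm]
  rcases k with k | k <;> rcases l with l | l
  · rw [Basis.prod_apply_inl_fst, Basis.prod_apply_inl_fst, Basis.prod_apply_inl_snd, hermOf_zero_left_aux,
      add_zero, horth₁]
    by_cases h : k = l
    · subst h; simp
    · rw [if_neg h, if_neg (fun h' ↦ h (Sum.inl_injective h'))]
  · rw [Basis.prod_apply_inl_fst, Basis.prod_apply_inr_fst, Basis.prod_apply_inl_snd, hermOf_zero_right_aux,
      hermOf_zero_left_aux, add_zero, if_neg Sum.inl_ne_inr]
  · rw [Basis.prod_apply_inr_fst, Basis.prod_apply_inr_snd, Basis.prod_apply_inl_snd, hermOf_zero_left_aux,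
      hermOf_zero_right_aux, add_zero, if_neg Sum.inr_ne_inl]
  · rw [Basis.prod_apply_inr_fst, Basis.prod_apply_inr_snd, Basis.prod_apply_inr_snd, hermOf_zero_left_aux,
      zero_add, horth₂]
    by_cases h : k = l
    · subst h; simp
    · rw [if_neg h, if_neg (fun h' ↦ h (Sum.inr_injective h'))]

/-- **INDEX ADDITIVITY (Sylvester): `index H_{η₁ ⊞ η₂} = index H_{η₁} + index H_{η₂}`** for `η₁, η₂` of type `(1,1)` and
non-degenerate. [cite: GohbergLancasterRodman2005, §2.3 Thm. 2.3.2] [cite: Lange2023AbelianVarietiesComplex, §1.6.2 (p0066) and §2.4.4 Cor. 2.4.24] -/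
theorem hermIndex_prodForm (h₁ : ∀ u v : E₁, η₁ ![I • u, I • v] = η₁ ![u, v])
    (h₂ : ∀ u v : E₂, η₂ ![I • u, I • v] = η₂ ![u, v])
    (hnd₁ : ∀ v : E₁, v ≠ 0 → ∃ w : E₁, η₁ ![v, w] ≠ 0) (hnd₂ : ∀ v : E₂, v ≠ 0 → ∃ w : E₂, η₂ ![v, w] ≠ 0) :
    hermIndex (prodForm η₁ η₂) = hermIndex η₁ + hermIndex η₂ := by
  classical
  obtain ⟨w₁, c₁, hc₁, horth₁, hi₁⟩ := exists_orthogonal_basis_hermIndex η₁ h₁ hnd₁ rfl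
  obtain ⟨w₂, c₂, hc₂, horth₂, hi₂⟩ := exists_orthogonal_basis_hermIndex η₂ h₂ hnd₂ rfl
  rw [hermIndex_eq_card_of_orthogonal _ (typeOneOne_prodForm η₁ η₂ h₁ h₂) (w₁.prod w₂) (Sum.elim c₁ c₂)
      (by rintro (k | k); exacts [hc₁ k, hc₂ k]) (hermOf_prodForm_basisProd η₁ η₂ w₁ w₂ c₁ c₂ horth₁ horth₂),
    hi₁, hi₂]
  simp only [Finset.card_filter, Fintype.sum_sum_type, Sum.elim_inl, Sum.elim_inr]
  congr 1

/-- `η₁ ⊞ η₂` is non-degenerate when both summands are (of type `(1,1)`). [cite: GohbergLancasterRodman2005, §2.2] -/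
theorem nondegenerate_prodForm (h₁ : ∀ u v : E₁, η₁ ![I • u, I • v] = η₁ ![u, v])
    (h₂ : ∀ u v : E₂, η₂ ![I • u, I • v] = η₂ ![u, v])
    (hnd₁ : ∀ v : E₁, v ≠ 0 → ∃ w : E₁, η₁ ![v, w] ≠ 0) (hnd₂ : ∀ v : E₂, v ≠ 0 → ∃ w : E₂, η₂ ![v, w] ≠ 0) :
    ∀ v : E₁ × E₂, v ≠ 0 → ∃ u : E₁ × E₂, prodForm η₁ η₂ ![v, u] ≠ 0 := by
  classical
  obtain ⟨w₁, c₁, hc₁, horth₁, -⟩ := exists_orthogonal_basis_hermIndex η₁ h₁ hnd₁ rfl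
  obtain ⟨w₂, c₂, hc₂, horth₂, -⟩ := exists_orthogonal_basis_hermIndex η₂ h₂ hnd₂ rfl
  exact exists_apply_ne_zero_of_orthogonal _ (typeOneOne_prodForm η₁ η₂ h₁ h₂) (w₁.prod w₂) (Sum.elim c₁ c₂)
    (by rintro (k | k); exacts [hc₁ k, hc₂ k]) (hermOf_prodForm_basisProd η₁ η₂ w₁ w₂ c₁ c₂ horth₁ horth₂)

variable {ι₁ ι₂ : Type*} [Fintype ι₁] [Fintype ι₂] {Φ₁ : (ι₁ → ℝ) ≃L[ℝ] E₁} {Φ₂ : (ι₂ → ℝ) ≃L[ℝ] E₂}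

omit [Fintype ι₁] [Fintype ι₂] in
/-- The `NS` wording: for `ηᵢ ∈ NS(Xᵢ)` non-degenerate, `index(η₁ ⊞ η₂) = index η₁ + index η₂` on `X₁ × X₂`
(e.g. file IV's `E_τ ⊞ (−E_τ')`: `0 + 1 = 1`; file IVb's `(E_τ ⊞ E_τ) ⊞ (E_τ ⊞ (−E_τ))`: `(0+0) + (0+1) = 1`).
[cite: Lange2023AbelianVarietiesComplex, §1.6.2 (p0066) and §2.4.4 Cor. 2.4.24] -/
theorem hermIndex_prodForm_of_isNSForm (hη₁ : IsNSForm Φ₁ η₁) (hη₂ : IsNSForm Φ₂ η₂)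
    (hnd₁ : ∀ v : E₁, v ≠ 0 → ∃ w : E₁, η₁ ![v, w] ≠ 0) (hnd₂ : ∀ v : E₂, v ≠ 0 → ∃ w : E₂, η₂ ![v, w] ≠ 0) :
    hermIndex (prodForm η₁ η₂) = hermIndex η₁ + hermIndex η₂ :=
  hermIndex_prodForm η₁ η₂ hη₁.type_one_one hη₂.type_one_one hnd₁ hnd₂

/-- **(H1) FOR A PRODUCT CLASS ⟺ PARITY OF THE SUM OF THE INDICES.** For `ηᵢ ∈ NS(Xᵢ)` non-degenerate on complex tori
`X₁, X₂` with `dim (X₁ × X₂) = g` (`e` pins `2g = |ι₁| + |ι₂|`):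
`0 < ∫_{X₁×X₂} (η₁ ⊞ η₂)^{∧g} ⟺ Even (g + (hermIndex η₁ + hermIndex η₂))`.
[cite: Lange2023AbelianVarietiesComplex, §1.7.2 Lemma 1.7.5 and proof of Thm. 1.7.3, with §2.4.4 Cor. 2.4.24] -/
theorem torusIntegral_wedgePow_prodForm_pos_iff [DecidableEq ι₁] [DecidableEq ι₂] (hη₁ : IsNSForm Φ₁ η₁)
    (hη₂ : IsNSForm Φ₂ η₂) (hnd₁ : ∀ v : E₁, v ≠ 0 → ∃ w : E₁, η₁ ![v, w] ≠ 0)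
    (hnd₂ : ∀ v : E₂, v ≠ 0 → ∃ w : E₂, η₂ ![v, w] ≠ 0) {g : ℕ} (e : Fin (2 * g) ≃ ι₁ ⊕ ι₂) :
    0 < torusIntegral (prodPeriod Φ₁ Φ₂) e (wedgePow (ofRealForm (prodForm η₁ η₂)) g) ↔
      Even (g + (hermIndex η₁ + hermIndex η₂)) := by
  rw [torusIntegral_wedgePow_pos_iff_even' _ (hη₁.prod hη₂)
    (nondegenerate_prodForm η₁ η₂ hη₁.type_one_one hη₂.type_one_one hnd₁ hnd₂) e,
    hermIndex_prodForm_of_isNSForm η₁ η₂ hη₁ hη₂ hnd₁ hnd₂]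

/-- … at EVEN dimension `g` ((S3)'s range): `0 < ∫_{X₁×X₂} (η₁ ⊞ η₂)^{∧g} ⟺ Even (hermIndex η₁ + hermIndex η₂)` — two
polarisations, or two classes of odd index, pass the (H1) gate; a polarisation `⊞` an odd-index class does not.
[cite: Lange2023AbelianVarietiesComplex, §1.7.1 Thm. 1.7.1 and §1.7.2 Thm. 1.7.3] -/
theorem torusIntegral_wedgePow_prodForm_pos_iff_of_even [DecidableEq ι₁] [DecidableEq ι₂] (hη₁ : IsNSForm Φ₁ η₁)
    (hη₂ : IsNSForm Φ₂ η₂) (hnd₁ : ∀ v : E₁, v ≠ 0 → ∃ w : E₁, η₁ ![v, w] ≠ 0)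
    (hnd₂ : ∀ v : E₂, v ≠ 0 → ∃ w : E₂, η₂ ![v, w] ≠ 0) {g : ℕ} (hg : Even g) (e : Fin (2 * g) ≃ ι₁ ⊕ ι₂) :
    0 < torusIntegral (prodPeriod Φ₁ Φ₂) e (wedgePow (ofRealForm (prodForm η₁ η₂)) g) ↔
      Even (hermIndex η₁ + hermIndex η₂) := by
  rw [torusIntegral_wedgePow_prodForm_pos_iff η₁ η₂ hη₁ hη₂ hnd₁ hnd₂ e, Nat.even_add]
  exact ⟨fun h ↦ h.1 hg, fun h ↦ ⟨fun _ ↦ h, fun _ ↦ hg⟩⟩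

/-- … in particular two RIEMANN FORMS (polarisations; index `0` each): `0 < ∫_{X₁×X₂} (η₁ ⊞ η₂)^{∧g}` at every even `g` —
(H1) for the product of two structures of record. [cite: Lange2023AbelianVarietiesComplex, §1.7.2 Thm. 1.7.3 and §2.4.5 Exercise (8)] -/
theorem torusIntegral_wedgePow_prodForm_pos_of_isRiemannForm [DecidableEq ι₁] [DecidableEq ι₂]
    (hη₁ : IsRiemannForm Φ₁ η₁) (hη₂ : IsRiemannForm Φ₂ η₂) {g : ℕ} (hg : Even g) (e : Fin (2 * g) ≃ ι₁ ⊕ ι₂) :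
    0 < torusIntegral (prodPeriod Φ₁ Φ₂) e (wedgePow (ofRealForm (prodForm η₁ η₂)) g) := by
  rw [torusIntegral_wedgePow_prodForm_pos_iff_of_even η₁ η₂ hη₁.isNSForm hη₂.isNSForm
    (hη₁.exists_apply_ne_zero _) (hη₂.exists_apply_ne_zero _) hg e, hη₁.hermIndex_eq_zero, hη₂.hermIndex_eq_zero]
  norm_num

omit [FiniteDimensional ℂ E₂] in
/-- Non-degeneracy passes to `−η`. [folklore] -/
theorem nondegenerate_neg_aux (hnd : ∀ v : E₂, v ≠ 0 → ∃ w : E₂, η₂ ![v, w] ≠ 0) :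
    ∀ v : E₂, v ≠ 0 → ∃ w : E₂, (-η₂) ![v, w] ≠ 0 := fun v hv ↦ by
  obtain ⟨w, hw⟩ := hnd v hv
  exact ⟨w, by rwa [ContinuousAlternatingMap.neg_apply, neg_ne_zero]⟩

omit [Fintype ι₁] in
/-- **A POLARISATION ⊞ AN ANTI-POLARISATION has index `dim X₂`**: for Riemann forms `θ₁` on `X₁`, `θ₂` on `X₂`, the class
`θ₁ ⊞ (−θ₂) ∈ NS(X₁ × X₂)` has `index = 0 + dim X₂` — THE LAW behind file IV's hand-made witness `E_τ ⊞ (−E_τ')` (index `1`).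
[cite: Lange2023AbelianVarietiesComplex, §1.6.2 (p0066) and §2.4.4 Cor. 2.4.24] -/
theorem hermIndex_prodForm_neg_of_isRiemannForm (hη₁ : IsRiemannForm Φ₁ η₁) (hη₂ : IsRiemannForm Φ₂ η₂) :
    hermIndex (prodForm η₁ (-η₂)) = finrank ℂ E₂ := by
  rw [hermIndex_prodForm η₁ (-η₂) hη₁.1 (fun u v ↦ by simp only [ContinuousAlternatingMap.neg_apply, hη₂.1 u v])
    (hη₁.exists_apply_ne_zero _) (nondegenerate_neg_aux η₂ (hη₂.exists_apply_ne_zero _)), hη₁.hermIndex_eq_zero,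
    hη₂.hermIndex_neg, zero_add]

/-- … hence on `X₁ × X₂` of EVEN dimension `g`: **`θ₁ ⊞ (−θ₂)` passes the (H1) gate iff `dim X₂` is even** (`E_τ ⊞ (−E_τ')`: `dim = 1`, fails —
file IV's `∫ = -2`; `(θ₁ on a surface) ⊞ (−θ₂ on a surface)`: passes). [cite: Lange2023AbelianVarietiesComplex, §1.7.1 Thm. 1.7.1 and §1.7.2 Thm. 1.7.3] -/
theorem torusIntegral_wedgePow_prodForm_neg_pos_iff_of_isRiemannForm [DecidableEq ι₁] [DecidableEq ι₂]
    (hη₁ : IsRiemannForm Φ₁ η₁) (hη₂ : IsRiemannForm Φ₂ η₂) {g : ℕ} (hg : Even g) (e : Fin (2 * g) ≃ ι₁ ⊕ ι₂) :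
    0 < torusIntegral (prodPeriod Φ₁ Φ₂) e (wedgePow (ofRealForm (prodForm η₁ (-η₂))) g) ↔ Even (finrank ℂ E₂) := by
  rw [torusIntegral_wedgePow_prodForm_pos_iff_of_even η₁ (-η₂) hη₁.isNSForm hη₂.isNSForm.neg (hη₁.exists_apply_ne_zero _)
    (nondegenerate_neg_aux η₂ (hη₂.exists_apply_ne_zero _)) hg e, hη₁.hermIndex_eq_zero, hη₂.hermIndex_neg, zero_add]

end Prod

/-! ### §2 Sylvester additivity for the finite product `⊞_{k<r} η_k` on `X₀ × ⋯ × X_{r-1}` (one ambient space) -/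

section Pi

variable {E : Type*} [NormedAddCommGroup E] [NormedSpace ℂ E] [FiniteDimensional ℂ E] {n : ℕ}
  (η : Fin n → (E [⋀^Fin 2]→L[ℝ] ℝ))

omit [FiniteDimensional ℂ E] in
/-- `⊞_k η_k` is of type `(1,1)` when every `η_k` is. [cite: Lange2023AbelianVarietiesComplex, §2.4.4 Cor. 2.4.24 and Thm. 2.4.25] -/
theorem typeOneOne_piForm (h11 : ∀ k (u v : E), η k ![I • u, I • v] = η k ![u, v]) (u v : Fin n → E) :
    piForm η ![I • u, I • v] = piForm η ![u, v] := by
  rw [piForm_apply, piForm_apply]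
  exact Finset.sum_congr rfl fun k _ ↦ by rw [Pi.smul_apply, Pi.smul_apply, h11]

omit [FiniteDimensional ℂ E] in
/-- `H_{⊞η}` on vectors supported in single slots: `H(ι_k x, ι_l y) = δ_{kl} H_k(x, y)` (tree `hermOf_piForm`).
[cite: Lange2023AbelianVarietiesComplex, §2.4.4 Cor. 2.4.24 and Thm. 2.4.25] -/
theorem hermOf_piForm_single (k l : Fin n) (x y : E) :
    hermOf (piForm η) (Pi.single k x) (Pi.single l y) = if k = l then hermOf (η l) x y else 0 := by
  classical
  rw [hermOf_piForm]
  split_ifs with hkl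
  · subst hkl
    rw [Finset.sum_eq_single k (fun m _ hm ↦ by rw [Pi.single_eq_of_ne hm, hermOf_zero_left_aux])
      (fun h ↦ absurd (Finset.mem_univ _) h), Pi.single_eq_same, Pi.single_eq_same]
  · refine Finset.sum_eq_zero fun m _ ↦ ?_
    by_cases hm : m = k
    · subst hm
      rw [Pi.single_eq_of_ne hkl, hermOf_zero_right_aux]
    · rw [Pi.single_eq_of_ne hm, hermOf_zero_left_aux]

omit [FiniteDimensional ℂ E] in
/-- The product basis `(ι_k w_k(i))_{k,i}` (Mathlib `Pi.basis`) of `H_k`-orthogonal bases is `H_{⊞η}`-orthogonal with diagonal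
`c_k(i)`. [cite: GohbergLancasterRodman2005, §2.3 (2.3.8)] [cite: Lange2023AbelianVarietiesComplex, §2.4.4 Thm. 2.4.25] -/
theorem hermOf_piForm_piBasis {g : ℕ} (w : Fin n → Basis (Fin g) ℂ E) (c : Fin n → Fin g → ℝ)
    (horth : ∀ k i j, hermOf (η k) (w k i) (w k j) = if i = j then (c k i : ℂ) else 0)
    (p q : Σ _ : Fin n, Fin g) :
    hermOf (piForm η) (Pi.basis w p) (Pi.basis w q) = if p = q then ((c p.1 p.2 : ℝ) : ℂ) else 0 := by
  classical
  obtain ⟨k, i⟩ := p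
  obtain ⟨l, j⟩ := q
  rw [Pi.basis_apply, Pi.basis_apply, hermOf_piForm_single]
  by_cases hkl : k = l
  · subst hkl
    rw [if_pos rfl, horth]
    by_cases hij : i = j
    · subst hij; simp
    · rw [if_neg hij, if_neg (show (⟨k, i⟩ : Σ _ : Fin n, Fin g) ≠ ⟨k, j⟩ from
        fun h ↦ hij (eq_of_heq (Sigma.mk.inj_iff.1 h).2))]
  · rw [if_neg hkl, if_neg (show (⟨k, i⟩ : Σ _ : Fin n, Fin g) ≠ ⟨l, j⟩ from
        fun h ↦ hkl (Sigma.mk.inj_iff.1 h).1)]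

/-- **INDEX ADDITIVITY for `⊞_{k<r} η_k` (Sylvester): `index H_{⊞η} = Σ_k index H_{η_k}`.**
[cite: GohbergLancasterRodman2005, §2.3 Thm. 2.3.2] [cite: Lange2023AbelianVarietiesComplex, §1.6.2 (p0066) and §2.4.4 Thm. 2.4.25] -/
theorem hermIndex_piForm (h11 : ∀ k (u v : E), η k ![I • u, I • v] = η k ![u, v])
    (hnd : ∀ k (v : E), v ≠ 0 → ∃ u : E, η k ![v, u] ≠ 0) :
    hermIndex (piForm η) = ∑ k, hermIndex (η k) := by
  classical
  choose w c hc horth hi using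
    fun k ↦ exists_orthogonal_basis_hermIndex (η k) (h11 k) (hnd k) (rfl : finrank ℂ E = finrank ℂ E)
  rw [hermIndex_eq_card_of_orthogonal _ (typeOneOne_piForm η h11) (Pi.basis w) (fun p ↦ c p.1 p.2)
      (fun p ↦ hc p.1 p.2) (hermOf_piForm_piBasis η w c horth)]
  simp only [hi, Finset.card_filter]
  exact Fintype.sum_sigma (fun p : Σ _ : Fin n, Fin (finrank ℂ E) ↦ if c p.1 p.2 < 0 then 1 else 0)

/-- `⊞_k η_k` is non-degenerate when every `η_k` is (type `(1,1)`). [cite: GohbergLancasterRodman2005, §2.2] -/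
theorem nondegenerate_piForm (h11 : ∀ k (u v : E), η k ![I • u, I • v] = η k ![u, v])
    (hnd : ∀ k (v : E), v ≠ 0 → ∃ u : E, η k ![v, u] ≠ 0) :
    ∀ v : Fin n → E, v ≠ 0 → ∃ u : Fin n → E, piForm η ![v, u] ≠ 0 := by
  classical
  choose w c hc horth hi using
    fun k ↦ exists_orthogonal_basis_hermIndex (η k) (h11 k) (hnd k) (rfl : finrank ℂ E = finrank ℂ E)
  exact exists_apply_ne_zero_of_orthogonal _ (typeOneOne_piForm η h11) (Pi.basis w) (fun p ↦ c p.1 p.2)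
    (fun p ↦ hc p.1 p.2) (hermOf_piForm_piBasis η w c horth)

variable {ι : Type*} [Fintype ι] {Φ : Fin n → ((ι → ℝ) ≃L[ℝ] E)}

omit [Fintype ι] in
/-- The `NS` wording on the product torus `X₀ × ⋯ × X_{r-1}` (`piPeriod Φ`): for `η_k ∈ NS(X_k)` non-degenerate,
`index(⊞_k η_k) = Σ_k index η_k`. [cite: Lange2023AbelianVarietiesComplex, §1.6.2 (p0066) and §2.4.4 Thm. 2.4.25] -/
theorem hermIndex_piForm_of_isNSForm (hη : ∀ k, IsNSForm (Φ k) (η k))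
    (hnd : ∀ k (v : E), v ≠ 0 → ∃ u : E, η k ![v, u] ≠ 0) :
    hermIndex (piForm η) = ∑ k, hermIndex (η k) :=
  hermIndex_piForm η (fun k ↦ (hη k).type_one_one) hnd

/-- **(H1) FOR `⊞_k η_k` ⟺ PARITY OF `g + Σ_k index η_k`** (`g = dim ∏ X_k`, pinned by `e`).
[cite: Lange2023AbelianVarietiesComplex, §1.7.2 Lemma 1.7.5 and proof of Thm. 1.7.3, with §2.4.4 Thm. 2.4.25] -/
theorem torusIntegral_wedgePow_piForm_pos_iff [DecidableEq ι] (hη : ∀ k, IsNSForm (Φ k) (η k))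
    (hnd : ∀ k (v : E), v ≠ 0 → ∃ u : E, η k ![v, u] ≠ 0) {g : ℕ} (e : Fin (2 * g) ≃ Fin n × ι) :
    0 < torusIntegral (piPeriod Φ) e (wedgePow (ofRealForm (piForm η)) g) ↔ Even (g + ∑ k, hermIndex (η k)) := by
  rw [torusIntegral_wedgePow_pos_iff_even' _ (IsNSForm.pi hη)
    (nondegenerate_piForm η (fun k ↦ (hη k).type_one_one) hnd) e, hermIndex_piForm_of_isNSForm η hη hnd]

end Pi

end SecantParity

end Summit.Ventures.HSemireg
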